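import Summits.QuantumFields.YangMills.Theorems.AlphaInputsT3ACv3StartDefectTwoCell
import Summits.QuantumFields.YangMills.Theorems.AlphaInputsT3ACv3RegionAxialGauge
import Summits.QuantumFields.YangMills.Theorems.AlphaInputsT3ACv3RelativeGaugeDrift
import Summits.QuantumFields.YangMills.Theorems.AlphaInputsT3ACv3FLContractionCore
import HarnessLib

/-!
# `AlphaInputsT3ACv3NewtonLiftStencilRows` — STRATEGY B for 2′, the (FL) row under OWNER RULING g24-№4: **THE ADAPTER «START plaquette bound ⇒ stencil-gauge rows» OF THE REGIONAL NEWTON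
# LIFT** — with the CENTRE-ANCHORED comb gauge `σ_c := axialT U (toFine k c₋)` of every coarse bond `c` (★w5's (S6) gauge) and the stencil `N_c :=` the two `k`-blocks of `c`: (1) the
# flatness `‖(U^{σ_c})_b − 1‖ ≤ (d·⌊L^k∕2⌋ + L^k)·δ₀` on every bond of the two blocks from the START's plaquette bound `δ₀` on the two-cell box, i.e. the `x∕L^k` row of
# `exists_exact_lift_regional_window_kfree` with `x = (d∕2+1)·L^{2k}·δ₀` k-FREE for `δ₀ = B₀·ε′∕L^{2k}`; (2) the one-block OSCILLATION `ω` of the relative gauge `σ_cσ_{c′}⁻¹` between a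
# site of the block of `c′₋` and its centre, from the same bound — the `hosc` binder of `exists_obLift_gaugeKernel` (γ) — lane `pub-balaban3d` ∕ cell `ym3-torus`, seat `ym-ust-19936-w4` (g2)

WHY (cell `ym3-torus` 2026-08-28: ★★OWNER g25 03:41:07Z «the 30-line ADAPTER «δ₀ ⇒ stencil flatness x = X·ε′ via the anchored comb gauge» for ★w4's (H) := ★w4-19936 g2»; ★w1-19936 g2
LEAD 04:55Z «the START side delivers `(U₀ := startT3, δ₀, η₀ := 2(d+1)L^k·D·δ₀ via ★w5)`; your x = X·ε′ stencil flatness comes from δ₀»).  ★w5 g2's `…StartDefectTwoCell` (p602879) fixed the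
chart of record: the two-cell PRODUCT SET `twoCellSet k c κ` with `mem_twoCellSet_of_mem_blocks`, `hwrap_twoCell`, `hfan_twoCell`, `hl1_twoCell`, and the comb gauge from the CENTRE `toFine k c₋`.
THIS FILE reads this seat's binders off that chart:
* §1 ★★ `norm_gaugeAct_centreAxial_sub_one_le` — the `hU₀` binder of (D)∕(E′)∕(H) at `σ c := axialT U (toFine k c₋)`, `N c := {iterBlockOf k · ∈ {c₋, c₊}}` (so `hN` is `id`):
  flatness `≤ (d·⌊L^k∕2⌋ + L^k)·δ₀` from the plaquette bound on the two-cell box (★w1 g0's `RegionAxialGauge.dist1_gaugeActT_axialT_le_of_box` + ★w5's fan letters).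
* §2 the ONE-BLOCK chart for the drift (def-free: an auxiliary transverse direction `α ≠ κ`, `d ≥ 2`): ★ `hbox_oneCell` (the coordinate box from the centre to a site of the block stays in the
  one-block product set), ★ `iterBlockOf_eq_of_mem_oneCell` (the one-block product set IS the block), and ★★★ `norm_relGauge_centreAxial_osc_le` — the `hosc` binder of (I)
  `exists_obLift_gaugeKernel`: `‖σ_c(x)σ_{c′}(x)⁻¹ − σ_c^{(k)}(c′₋)σ_{c′}^{(k)}(c′₋)⁻¹‖ ≤ (η + η′)·(d·⌊L^k∕2⌋)` for `x` in the block of `c′₋` whenever both gauged fields are `η`, `η′`-flat on the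
  bonds of that block ((G) `norm_relGauge_comb_sub_le_pi` from the centre) — so `ω = O(L^k·(η+η′)) = O(x)`, k-FREE.
HONEST FRAMING.  Bookkeeping over ★w5's chart, ★w1's regional axial gauge and this seat's (G); the plaquette bound on the two-cell box is the START's ((S5) `dist1_plaqHol_startT3_le` +
saturation, LEAD's (iii)); `hLift`, the stub 2′χ, the crux and any gap are NOT claimed; count-neutral helper toward R3 2′ (items 19936∕19935); registry untouched; nothing about d = 4, the
continuum, or a mass gap; YM₃ on T³ is rung R3, not Clay.

References: T. Bałaban, Commun. Math. Phys. 98 (1985) 17–51 [Balaban1985Averaging] ((8) p.18, (19) p.21, pp.24–25); CMP 102 (1985) 277–309 [Balaban1985Variational] ((18) p.280);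
CMP 109 (1987) 249–301 [Balaban1987RG1] ((0.1) p.251).
-/

set_option autoImplicit false

noncomputable section

open scoped Matrix.Norms.L2Operator
namespace Summit.QuantumFields.YangMills.Theorems.NewtonLiftFramed

open Literature.MathematicalPhysics.QuantumFieldTheory.Balaban1983to89
open T4Continuum
open B10Eq27TorusAxialLog (axialT gaugeActT rel rel_apply gaugeActT_eq_gaugeAct)
open B7Prop1Explicit (l1)
open Literature.MathematicalPhysics.QuantumFieldTheory.Balaban1983to89.B5Eq118OneStroke (iterBlockOf val_iterBlockOf)
open Literature.MathematicalPhysics.QuantumFieldTheory.Balaban1983to89.B10Eq38TorusDomains (toFine)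
open Summit.QuantumFields.YangMills.Theorems.StartDefectBox (blockStart winHi twoCellSet mem_twoCellSet_of_mem_blocks rel_window hwrap_twoCell hfan_twoCell hl1_twoCell toFine_src_eq_blockStart)
open Summit.QuantumFields.YangMills.Theorems.RegionAxialGauge (dist1_gaugeActT_axialT_le_of_box)
open Summit.QuantumFields.YangMills.Theorems.Prop7FlatHolonomy (sitesPerDir_zero_eq_mul_pow)
open Summit.QuantumFields.YangMills.Theorems.FLContraction (transfUp_eq_toFine)
open Summit.QuantumFields.YangMills.Theorems.PerturbedPlaquette (dist1_SU_eq)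

variable {P : Params} {k : ℕ} {n : Type*} [Fintype n] [DecidableEq n] [Nonempty n]

/-! ## §1 The stencil-gauge flatness row from the plaquette bound on the two-cell box -/

/-- **★★ THE `hU₀` BINDER OF THE REGIONAL LIFT AT THE CENTRE-ANCHORED COMB GAUGE** (`k ≤ m + K`, `4L^k ≤ sitesPerDir 0`): if every finest plaquette with lower and upper corners in the
two-cell product set of `c` is within `δ ≥ 0` of `1`, then for the comb gauge `σ_c = axialT U (toFine k c₋)` and every finest bond `b` with both endpoints in the two `k`-blocks of `c`,
`‖(U^{σ_c})_b − 1‖ ≤ (d·⌊L^k∕2⌋ + L^k)·δ` — with `δ = δ₀ = B₀·ε′∕L^{2k}` this is `x∕L^k`, `x = (d∕2 + 1)·B₀·ε′` k-FREE. [cite: Balaban1985Averaging, (8) p.18, pp.24–25; Balaban1985Variational, (18) p.280] -/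
theorem norm_gaugeAct_centreAxial_sub_one_le (hk : k ≤ P.m + P.K) (hN4 : 4 * P.L ^ k ≤ P.sitesPerDir 0) (U : GaugeField P 0 (Matrix.specialUnitaryGroup n ℂ)) (c : PBond P k)
    {δ : ℝ} (hδ : 0 ≤ δ)
    (hU : ∀ q : Plaq P 0, (∀ κ, q.src κ ∈ twoCellSet k c κ) → (∀ κ, ((q.src.shift q.μ).shift q.ν) κ ∈ twoCellSet k c κ) → GaugeGroup.dist1 (GaugeField.plaqHol U q) ≤ δ)
    (b : PBond P 0) (hs : iterBlockOf k b.src = c.src ∨ iterBlockOf k b.src = c.tgt) (ht : iterBlockOf k b.tgt = c.src ∨ iterBlockOf k b.tgt = c.tgt) :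
    ‖((GaugeField.gaugeAct (axialT U (toFine k c.src)) U b : Matrix.specialUnitaryGroup n ℂ) : Matrix n n ℂ) - 1‖ ≤ ((P.d * (P.L ^ k / 2) + P.L ^ k : ℕ) : ℝ) * δ := by
  obtain ⟨x, μ⟩ := b
  have ht' : iterBlockOf k (x.shift μ) = c.src ∨ iterBlockOf k (x.shift μ) = c.tgt := ht
  have h := dist1_gaugeActT_axialT_le_of_box U (I := twoCellSet k c) hδ (fun q h1 h2 => hU q h1 h2) (toFine k c.src) x μ (hwrap_twoCell hk hN4 c x hs μ)
    (fun κ t ht1 ht2 => hfan_twoCell hk hN4 c x hs μ ht' κ t ht1 ht2)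
  have hl := hl1_twoCell hk hN4 c x hs
  rw [← dist1_SU_eq, ← gaugeActT_eq_gaugeAct]
  refine h.trans (mul_le_mul_of_nonneg_right (by exact_mod_cast hl) hδ)

/-! ## §2 The one-block chart and the oscillation of the relative gauge -/

section OneCell

omit [Fintype n] [DecidableEq n] [Nonempty n] in
/-- In the direction `κ`, the two-cell window of an auxiliary bond `⟨y, α⟩` with `α ≠ κ` is the ONE-block window `L^k − 1` (the one-block product set of `y` is read through the
two-cell sets of the transverse bonds at `y`; needs `d ≥ 2`). [folklore] -/
theorem winHi_oneCell (y : Site P k) {α κ : Fin P.d} (hα : α ≠ κ) : winHi k (⟨y, α⟩ : PBond P k) κ = P.L ^ k - 1 := by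
  unfold winHi
  rw [if_neg hα.symm]

omit [Fintype n] [DecidableEq n] [Nonempty n] in
/-- **★ THE COORDINATE BOX FROM THE CENTRE TO A SITE OF THE BLOCK STAYS IN THE ONE-BLOCK PRODUCT SET** (`4L^k ≤ sitesPerDir 0`): for `x` with `iterBlockOf k x = y`, every `t` between
`0` and `rel (toFine k y) x κ` gives a label `(toFine k y) κ + t` of the one-block window in direction `κ` (★w5's `rel_window` through the auxiliary transverse bond).
[cite: Balaban1985Averaging, pp.24–25; Balaban1987RG1, (0.1) p.251] -/
theorem hbox_oneCell (hk : k ≤ P.m + P.K) (hN4 : 4 * P.L ^ k ≤ P.sitesPerDir 0) (y : Site P k) (x : Site P 0) (hx : iterBlockOf k x = y) {α κ : Fin P.d} (hα : α ≠ κ) (t : ℤ)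
    (ht1 : min 0 (rel (toFine k y) x κ) ≤ t) (ht2 : t ≤ max 0 (rel (toFine k y) x κ)) :
    (toFine k y) κ + ((t : ℤ) : ZMod (P.sitesPerDir 0)) ∈ twoCellSet k (⟨y, α⟩ : PBond P k) κ := by
  set c'' : PBond P k := ⟨y, α⟩ with hc''
  have hx' : iterBlockOf k x = c''.src ∨ iterBlockOf k x = c''.tgt := Or.inl hx
  have hw : -((P.L ^ k / 2 : ℕ) : ℤ) ≤ rel (toFine k y) x κ ∧ rel (toFine k y) x κ ≤ (winHi k c'' κ : ℤ) - ((P.L ^ k / 2 : ℕ) : ℤ) :=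
    rel_window hk hN4 c'' x hx' κ
  rw [winHi_oneCell y hα] at hw
  have h2 := TubeStart.pow_eq_two_mul_half_add_one (P := P) k
  have hpos : 0 < P.L ^ k := pow_pos P.L_pos k
  -- `−h ≤ t ≤ h`
  have hlo : -((P.L ^ k / 2 : ℕ) : ℤ) ≤ t := le_trans (le_min (by omega) hw.1) ht1
  have hhi : t ≤ ((P.L ^ k / 2 : ℕ) : ℤ) := ht2.trans (max_le (by omega) (by omega))
  refine ⟨(((P.L ^ k / 2 : ℕ) : ℤ) + t).toNat, by rw [winHi_oneCell y hα]; omega, ?_⟩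
  have hc : (toFine k y) κ = blockStart k c'' κ + ((P.L ^ k / 2 : ℕ) : ZMod (P.sitesPerDir 0)) := toFine_src_eq_blockStart hk c'' κ
  rw [hc, add_assoc]
  congr 1
  have h0 : 0 ≤ ((P.L ^ k / 2 : ℕ) : ℤ) + t := by omega
  rw [← Int.cast_natCast (R := ZMod (P.sitesPerDir 0)) (((P.L ^ k / 2 : ℕ) : ℤ) + t).toNat, Int.toNat_of_nonneg h0, Int.cast_add, Int.cast_natCast]

omit [Fintype n] [DecidableEq n] [Nonempty n] in
/-- **★ THE ONE-BLOCK PRODUCT SET IS THE BLOCK**: a fine site all of whose labels lie in the one-block windows of `y` has `iterBlockOf k z = y` (no wrap: `sitesPerDir 0 = sitesPerDir k · L^k`).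
[cite: Balaban1987RG1, (0.1) p.251] -/
theorem iterBlockOf_eq_of_mem_oneCell (hk : k ≤ P.m + P.K) (y : Site P k) (α : Fin P.d → Fin P.d) (hα : ∀ κ, α κ ≠ κ) (z : Site P 0)
    (hz : ∀ κ, z κ ∈ twoCellSet k (⟨y, α κ⟩ : PBond P k) κ) : iterBlockOf k z = y := by
  funext κ
  apply ZMod.val_injective
  obtain ⟨u, hu, hzu⟩ := hz κ
  rw [winHi_oneCell y (hα κ)] at hu
  have hpos : 0 < P.L ^ k := pow_pos P.L_pos k
  have hN : P.sitesPerDir 0 = P.sitesPerDir k * P.L ^ k := sitesPerDir_zero_eq_mul_pow hk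
  have hyv : (y κ).val < P.sitesPerDir k := ZMod.val_lt _
  have hval : (z κ).val = (y κ).val * P.L ^ k + u := by
    rw [hzu]
    show (blockStart k (⟨y, α κ⟩ : PBond P k) κ + ((u : ℕ) : ZMod (P.sitesPerDir 0))).val = _
    rw [blockStart, ← Nat.cast_add, ZMod.val_natCast]
    refine Nat.mod_eq_of_lt ?_
    show (y κ).val * P.L ^ k + u < P.sitesPerDir 0
    rw [hN]
    have : (y κ).val * P.L ^ k + u < ((y κ).val + 1) * P.L ^ k := by rw [add_mul, one_mul]; omega
    exact lt_of_lt_of_le this (Nat.mul_le_mul_right _ hyv)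
  rw [val_iterBlockOf k hk, hval]
  rw [add_comm, Nat.add_mul_div_right _ _ hpos, Nat.div_eq_of_lt (by omega), zero_add]

/-- **★★★ THE `hosc` BINDER OF THE `obLift` CERTIFICATE FROM FLATNESS** (`k ≤ m + K`, `4L^k ≤ sitesPerDir 0`, `d ≥ 2`).  Two finest gauges `g, g′` (the stencil gauges `σ_c`, `σ_{c′}`)
whose gauged fields are `η`-, `η′`-flat on every finest bond with both endpoints in the `k`-block of `y` (`iterBlockOf k · = y`); then for every fine site `x` of that block the
relative gauge `t = g·g′⁻¹` satisfies `‖t(x) − t^{(k)}(y)‖ ≤ (η + η′)·(d·⌊L^k∕2⌋)` (`t^{(k)}(y) = g^{(k)}(y)·g′^{(k)}(y)⁻¹ = t(toFine k y)`): the comb from the centre stays in the block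
((G) `norm_relGauge_comb_sub_le_pi` on the one-block product set). With `η, η′ = O(ε′∕L^k)`: `ω = O(d·ε′)`, k-FREE. [cite: Balaban1985Averaging, (8) p.18, (19) p.21, pp.24–25] -/
theorem norm_relGauge_centre_osc_le (hd : 2 ≤ P.d) (hk : k ≤ P.m + P.K) (hN4 : 4 * P.L ^ k ≤ P.sitesPerDir 0)
    (g g' : GaugeTransf P 0 (Matrix.specialUnitaryGroup n ℂ)) (U : GaugeField P 0 (Matrix.specialUnitaryGroup n ℂ)) (y : Site P k) {η η' : ℝ} (hη : 0 ≤ η) (hη' : 0 ≤ η')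
    (hg : ∀ b : PBond P 0, iterBlockOf k b.src = y → iterBlockOf k b.tgt = y → ‖((GaugeField.gaugeAct g U b : Matrix.specialUnitaryGroup n ℂ) : Matrix n n ℂ) - 1‖ ≤ η)
    (hg' : ∀ b : PBond P 0, iterBlockOf k b.src = y → iterBlockOf k b.tgt = y → ‖((GaugeField.gaugeAct g' U b : Matrix.specialUnitaryGroup n ℂ) : Matrix n n ℂ) - 1‖ ≤ η')
    (x : Site P 0) (hx : iterBlockOf k x = y) :
    ‖((g x * (g' x)⁻¹ : Matrix.specialUnitaryGroup n ℂ) : Matrix n n ℂ) - ((transfUp g k y * (transfUp g' k y)⁻¹ : Matrix.specialUnitaryGroup n ℂ) : Matrix n n ℂ)‖ ≤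
      (η + η') * ((P.d * (P.L ^ k / 2) : ℕ) : ℝ) := by
  -- an auxiliary transverse direction per coordinate (`d ≥ 2`), the one-block product set, the flatness on its bonds
  let α : Fin P.d → Fin P.d := fun κ => if κ = ⟨0, by omega⟩ then ⟨1, by omega⟩ else ⟨0, by omega⟩
  have hα : ∀ κ, α κ ≠ κ := fun κ => by
    dsimp only [α]
    split_ifs with h
    · rw [h]; exact fun e => absurd (congrArg Fin.val e) (by norm_num)
    · exact fun e => h e.symm
  let I : Fin P.d → Set (ZMod (P.sitesPerDir 0)) := fun κ => twoCellSet k (⟨y, α κ⟩ : PBond P k) κ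
  have hmem : ∀ z : Site P 0, z ∈ {z : Site P 0 | ∀ κ, z κ ∈ I κ} → iterBlockOf k z = y := fun z hz => iterBlockOf_eq_of_mem_oneCell hk y α hα z hz
  have h₁ : ∀ b : PBond P 0, b.src ∈ {z : Site P 0 | ∀ κ, z κ ∈ I κ} → b.tgt ∈ {z : Site P 0 | ∀ κ, z κ ∈ I κ} →
      ‖((GaugeField.gaugeAct g U b : Matrix.specialUnitaryGroup n ℂ) : Matrix n n ℂ) - 1‖ ≤ η := fun b hs ht => hg b (hmem _ hs) (hmem _ ht)
  have h₂ : ∀ b : PBond P 0, b.src ∈ {z : Site P 0 | ∀ κ, z κ ∈ I κ} → b.tgt ∈ {z : Site P 0 | ∀ κ, z κ ∈ I κ} →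
      ‖((GaugeField.gaugeAct g' U b : Matrix.specialUnitaryGroup n ℂ) : Matrix n n ℂ) - 1‖ ≤ η' := fun b hs ht => hg' b (hmem _ hs) (hmem _ ht)
  have h := norm_relGauge_comb_sub_le_pi g g' U (I := I) h₁ h₂ (toFine k y) x (fun κ t ht1 ht2 => hbox_oneCell hk hN4 y x hx (hα κ) t ht1 ht2)
  -- the comb from the centre has at most `d·⌊L^k/2⌋` bonds
  have hl1 : l1 (rel (toFine k y) x) ≤ P.d * (P.L ^ k / 2) := by
    unfold l1
    have hb : ∀ κ, (rel (toFine k y) x κ).natAbs ≤ P.L ^ k / 2 := fun κ => by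
      have hw : -((P.L ^ k / 2 : ℕ) : ℤ) ≤ rel (toFine k y) x κ ∧
          rel (toFine k y) x κ ≤ (winHi k (⟨y, α κ⟩ : PBond P k) κ : ℤ) - ((P.L ^ k / 2 : ℕ) : ℤ) :=
        rel_window hk hN4 (⟨y, α κ⟩ : PBond P k) x (Or.inl hx) κ
      rw [winHi_oneCell y (hα κ)] at hw
      have h2 := TubeStart.pow_eq_two_mul_half_add_one (P := P) k
      have hpos : 0 < P.L ^ k := pow_pos P.L_pos k
      omega
    calc ∑ κ, (rel (toFine k y) x κ).natAbs ≤ ∑ _κ : Fin P.d, P.L ^ k / 2 := Finset.sum_le_sum fun κ _ => hb κ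
      _ = P.d * (P.L ^ k / 2) := by simp
  rw [transfUp_eq_toFine, transfUp_eq_toFine]
  exact h.trans (mul_le_mul_of_nonneg_left (by exact_mod_cast hl1) (add_nonneg hη hη'))

end OneCell

end Summit.QuantumFields.YangMills.Theorems.NewtonLiftFramed

end
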